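import Literature.NumberTheory.GaloisRepresentations.EulerSystem
import Literature.NumberTheory.GaloisRepresentations.CyclotomicCharacterFrobeniusProofs
import Literature.NumberTheory.EllipticCurves.IsogenyFrobeniusTraceProofs
import Literature.NumberTheory.EllipticCurves.KatoKolyvaginPrimes
import Literature.NumberTheory.EllipticCurves.HidaFamilyMembersProofs
import HarnessLib

/-!
# Rubin's Euler factor `P(Fr_q⁻¹ | T*; X)` of the Tate module of an elliptic curve over `ℚ` at a
# good prime, and the Kolyvagin-prime binders `hM₁` / `hM₂` of ROW T-DER (cell `b2b-bsdres`,
# team n1011; T-DER-INST-2 = K1, lead R5-75 ADD 3)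

HONEST FRAMING (cell `b2b-bsdres`, run/shared/lean/b2b/bsd-rank1-residual/, verbatim in every
file): the goal of the cell is to DELETE the COMBINATION-SHAPED residual classes of the
Birch–Swinnerton-Dyer formula for ALL analytic-rank `≤ 1` elliptic curves over `ℚ` — "full BSD
formula for every rank `≤ 1` curve in class `C`" assembled STRICTLY from published theorems — so
that the rank-`≤ 1` remainder becomes exactly the CONSTRUCTION-SHAPED classes, which are TYPED
(missing-input `Prop`s), NOT attempted. This is not "finishing BSD". Team n1011 (N10/N11, the
additive block `X4 ∧ p = 3`): research route on the CONSTRUCTION-SHAPED class X4 / §I N11; TOOL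
theorems only; nothing is booked; no mark / label / flag text moves; census −0.

## What

ROW T-DER (n1011-p11; THEOREM A2 `Derivative.conjMap_deriv_eq`) carries two CURVE-SIDE binders
per Kolyvagin prime `ℓ`: `hM₁ : (N_ℓ : A) • v = 0` and
`hM₂ : (rubinEulerFactor T.toRepresentation (cyclotomicCharacterToUnits K p A) Fr_ℓ).eval 1 • v = 0`
for all `v` in the coefficient module `M'` (`A = ℤ_[p]`), i.e. Rubin's "`ℓ ∈ 𝒫_M`": `M ∣ N_ℓ` and
`M ∣ P(Fr_ℓ⁻¹ | T*; 1)`.  This file DISCHARGES both over `ℚ` for `T = T_p E`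
(`T.toRepresentation = W.galoisRepTate p`, `N_ℓ = ℓ - 1`) from the tree's Kolyvagin-prime predicate
`Kato.IsKolyvaginPrime W p k ℓ` (`ℓ ∤ N p`, `ℓ ≡ 1`, `a_ℓ ≡ ℓ + 1 (mod p^k)`) and `p^k • M' = 0`:

* `charpoly_smul_dualMap_of_finrank_eq_two` — linear algebra: for `f` on a free rank-`2` module with
  `χ_f = X² − aX + d` and a scalar `c`, `χ_{c·f^∨} = X² − c a X + c² d`;
* `Rat.rubinEulerFactor_galoisRepTate` — **`P(Fr_q⁻¹ | T_pE*; X) = 1 − (a_q/q) X + (1/q) X²`** at a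
  place `v = q ≠ p` of good reduction (r1 GEN 27 rider R-A2, the dictionary between Rubin's `T*`
  convention and Kato's `det(1 − Fr_q t | T) = 1 − a_q t + q t²`, as a kernel identity): tree inputs
  `rubinEulerFactor_eq`, `trace_galoisRepTate_frobenius_eq_frobeniusTrace` +
  `det_galoisRepTate_frobenius_of_hasGoodReductionAt_holds` (Silverman C.21.3, theorems of the
  tree), `GaloisRep.cyclotomicCharacter_apply_of_isArithFrobAt` (`χ_p(Fr_q) = q`);
* `Rat.eval_one_rubinEulerFactor_galoisRepTate_mul` — `P(Fr_q⁻¹ | T*; 1) · q = q + 1 − a_q`;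
* `Rat.eval_one_rubinEulerFactor_galoisRepTate_smul_eq_zero` — **hM₂**;
* `Rat.natCast_sub_one_smul_eq_zero_of_isKolyvaginPrime` — **hM₁**.

Theorems only; 0 defs, 0 named facts, 0 sorry.  Ref (context only): Rubin, *Euler Systems* (2000)
Ch. III §5 (`P(Fr_q⁻¹ | T_pE*; x) = 1 − a_q q⁻¹ x + q⁻¹ x²`); Kato, Astérisque 295 (2004) 13.1,
Ex. 13.3 (`P_ℓ(t) = det(1 − Fr_ℓ t : T)`).
-/

noncomputable section

open Polynomial Field IsDedekindDomain
open scoped NumberField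

namespace Summit.BirchSwinnertonDyer.Rank1Residual.GaloisImage.CyclotomicLevel

open Literature.NumberTheory.GaloisRepresentations Literature.NumberTheory.EllipticCurves

/-! ## Linear algebra: the characteristic polynomial of a scaled dual map in rank `2` -/

section Algebra

variable {A : Type*} [CommRing A] [Nontrivial A] {M : Type*} [AddCommGroup M] [Module A M]
  [Module.Free A M] [Module.Finite A M]

/-- On a free module of rank `2`: if `χ_f(X) = X² − aX + d` then the scaled dual (transpose) map
`c · f^∨` on `Hom_A(M, A)` has `χ(X) = X² − c a X + c² d` (the transpose has the same
characteristic polynomial; scaling by `c` scales trace by `c` and determinant by `c²`). [folklore] -/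
theorem charpoly_smul_dualMap_of_finrank_eq_two (f : M →ₗ[A] M) {a d : A}
    (hf : f.charpoly = X ^ 2 - C a * X + C d) (h2 : Module.finrank A M = 2) (c : A) :
    (c • f.dualMap).charpoly = X ^ 2 - C (c * a) * X + C (c ^ 2 * d) := by
  classical
  let b := Module.finBasisOfFinrankEq A M h2
  -- the matrix of `f` and its trace / determinant
  set P := LinearMap.toMatrix b b f with hP
  have hPchar : P.charpoly = X ^ 2 - C a * X + C d := by
    rw [hP, LinearMap.charpoly_toMatrix, hf]
  have hfin : P.charpoly = X ^ 2 - C P.trace * X + C P.det := Matrix.charpoly_fin_two P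
  have htr : P.trace = a := by
    have h := congrArg (fun q : A[X] ↦ q.coeff 1) (hfin.symm.trans hPchar)
    simp only [coeff_add, coeff_sub, coeff_C_mul, coeff_X_pow, coeff_X_one, coeff_C,
      if_neg (one_ne_zero), mul_one] at h
    simpa using h
  have hdet : P.det = d := by
    have h := congrArg (fun q : A[X] ↦ q.coeff 0) (hfin.symm.trans hPchar)
    simpa using h
  -- the matrix of `c • f^∨` in the dual basis is `c • Pᵀ`
  have hQ : LinearMap.toMatrix b.dualBasis b.dualBasis (c • f.dualMap) = c • P.transpose := by
    rw [LinearEquiv.map_smul, LinearMap.dualMap_def, LinearMap.toMatrix_transpose]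
  rw [← LinearMap.charpoly_toMatrix (c • f.dualMap) b.dualBasis, hQ, Matrix.charpoly_fin_two,
    Matrix.trace_smul, Matrix.trace_transpose, Matrix.det_smul, Matrix.det_transpose,
    Fintype.card_fin, htr, hdet, smul_eq_mul]

end Algebra

/-! ## The Euler factor of `T_p E` over `ℚ` at a good place `v ∤ p` -/

namespace Rat

variable (W : WeierstrassCurve ℚ) [W.IsElliptic] [W.IsGloballyMinimal] (p : ℕ) [Fact p.Prime]

/-- **Rubin's Euler factor of the Tate module at a good prime.**  For a globally minimal elliptic
curve `W/ℚ`, a prime `p`, a finite place `v` of `ℚ` over a prime `q ≠ p` of good reduction and an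
arithmetic Frobenius `Fr` at `v`: `P(Fr⁻¹ | T_pE*; X) = 1 − (a_q/q)·X + (1/q)·X²` in `ℤ_p[X]`,
where `q = χ_p(Fr)` is a unit of `ℤ_p` and `a_q = W.frobeniusTrace q`.  Equivalently (Kato,
Astérisque 295, 13.1 / Ex. 13.3) `P(Fr⁻¹ | T*; X) = P^{Kato}_q(q⁻¹X)` with
`P^{Kato}_q(t) = det(1 − Fr_q t | T_pE) = 1 − a_q t + q t²`.  Rubin, *Euler Systems* Ch. III §5.
[folklore] -/
theorem rubinEulerFactor_galoisRepTate {v : HeightOneSpectrum (𝓞 ℚ)}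
    (hne : ((Rat.HeightOneSpectrum.primesEquiv v : Nat.Primes) : ℕ) ≠ p)
    (hv : W.HasGoodReductionAt v) {Fr : absoluteGaloisGroup ℚ} (hFr : IsArithFrobAtPlace ℚ v Fr) :
    haveI := W.module_free_tateModule_holds p
    haveI := W.module_finite_tateModule_holds p
    ∃ u : ℤ_[p]ˣ, (u : ℤ_[p]) = ((Rat.HeightOneSpectrum.primesEquiv v : Nat.Primes) : ℕ) ∧
      rubinEulerFactor (W.galoisRepTate p) (cyclotomicCharacterToUnits ℚ p ℤ_[p]) Fr =
        1 - C (↑u⁻¹ * (W.frobeniusTrace (Rat.HeightOneSpectrum.primesEquiv v) : ℤ_[p])) * X +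
          C (↑u⁻¹ : ℤ_[p]) * X ^ 2 := by
  haveI := W.module_free_tateModule_holds p
  haveI := W.module_finite_tateModule_holds p
  set q : ℕ := ((Rat.HeightOneSpectrum.primesEquiv v : Nat.Primes) : ℕ) with hqdef
  obtain ⟨𝔓, h𝔓, hσ⟩ := hFr
  have hp : (p : 𝓞 ℚ) ∉ v.asIdeal :=
    WeierstrassCurve.natCast_not_mem_asIdeal_of_primesEquiv_ne Fact.out hne
  -- the unit `u = χ_p(Fr)` with `u = N v = q`
  set u : ℤ_[p]ˣ := cyclotomicCharacterToUnits ℚ p ℤ_[p] Fr with hudef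
  have hres : (v.residueCard : ℤ_[p]) = (q : ℤ_[p]) := by
    rw [← WeierstrassCurve.natCard_residueField_eq_residueCard,
      WeierstrassCurve.natCard_residueField_adicCompletionIntegers]
  have hu : (u : ℤ_[p]) = q := by
    rw [hudef, coe_cyclotomicCharacterToUnits_apply]
    exact (GaloisRep.cyclotomicCharacter_apply_of_isArithFrobAt hp h𝔓 hσ).trans hres
  refine ⟨u, hu, ?_⟩
  -- the characteristic polynomial of `Fr` on `T_p E`: `X² − a_q X + q`
  have hchar : (W.galoisRepTate p Fr).charpoly =
      X ^ 2 - C (W.frobeniusTrace (Rat.HeightOneSpectrum.primesEquiv v) : ℤ_[p]) * X +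
        C (q : ℤ_[p]) := by
    have hpℚ : (p : ℚ) ≠ 0 := Nat.cast_ne_zero.mpr (Fact.out : p.Prime).ne_zero
    rw [WeierstrassCurve.charpoly_tateModule_eq hpℚ,
      W.trace_galoisRepTate_frobenius_eq_frobeniusTrace p hne hv h𝔓 hσ,
      W.det_galoisRepTate_frobenius_of_hasGoodReductionAt_holds p v hp hv h𝔓 hσ,
      WeierstrassCurve.natCard_residueField_adicCompletionIntegers]
  have h2 : Module.finrank ℤ_[p] (W.tateModule p) = 2 :=
    W.finrank_tateModule_eq_two_holds p (Nat.cast_ne_zero.mpr (Fact.out : p.Prime).ne_zero)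
  rw [rubinEulerFactor_eq, charpoly_smul_dualMap_of_finrank_eq_two _ hchar h2,
    Polynomial.reverse_X_sq_sub_C_mul_X_add_C]
  -- `c² q = c` for `c = u⁻¹`, `u = q`
  have hc : ((u⁻¹ : ℤ_[p]ˣ) : ℤ_[p]) ^ 2 * (q : ℤ_[p]) = ((u⁻¹ : ℤ_[p]ˣ) : ℤ_[p]) := by
    rw [← hu, sq, mul_assoc, Units.inv_mul, mul_one]
  rw [hc]

/-- **`P(Fr_q⁻¹ | T_pE*; 1) · q = q + 1 − a_q`** (so `P(1) ≡ 2 − a_q` up to the unit `q` when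
`q ≡ 1`): the value entering T-DER's `hM₂`. [folklore] -/
theorem eval_one_rubinEulerFactor_galoisRepTate_mul {v : HeightOneSpectrum (𝓞 ℚ)}
    (hne : ((Rat.HeightOneSpectrum.primesEquiv v : Nat.Primes) : ℕ) ≠ p)
    (hv : W.HasGoodReductionAt v) {Fr : absoluteGaloisGroup ℚ} (hFr : IsArithFrobAtPlace ℚ v Fr) :
    haveI := W.module_free_tateModule_holds p
    haveI := W.module_finite_tateModule_holds p
    (rubinEulerFactor (W.galoisRepTate p) (cyclotomicCharacterToUnits ℚ p ℤ_[p]) Fr).eval 1 *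
        (((Rat.HeightOneSpectrum.primesEquiv v : Nat.Primes) : ℕ) : ℤ_[p]) =
      (((Rat.HeightOneSpectrum.primesEquiv v : Nat.Primes) : ℕ) : ℤ_[p]) + 1 -
        (W.frobeniusTrace (Rat.HeightOneSpectrum.primesEquiv v) : ℤ_[p]) := by
  obtain ⟨u, hu, hP⟩ := rubinEulerFactor_galoisRepTate W p hne hv hFr
  rw [hP, ← hu]
  simp only [eval_add, eval_sub, eval_one, eval_mul, eval_C, eval_X, eval_pow, one_pow, mul_one]
  have h1 : ((u⁻¹ : ℤ_[p]ˣ) : ℤ_[p]) * (u : ℤ_[p]) = 1 := Units.inv_mul u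
  linear_combination (1 - (W.frobeniusTrace (Rat.HeightOneSpectrum.primesEquiv v) : ℤ_[p])) * h1

variable {p}

omit [Fact p.Prime] in
/-- Good reduction at (the place of) a Kolyvagin prime: `ℓ ∤ N` (`IsKolyvaginPrime.not_dvd_conductorNorm`,
`hasGoodReductionAtPrime_of_not_dvd_conductorNorm`, place ↔ prime by
`hasGoodReductionAtPrime_iff_hasGoodReductionAt_ringOfIntegers`). [folklore] -/
theorem hasGoodReductionAt_of_isKolyvaginPrime {k : ℕ} {v : HeightOneSpectrum (𝓞 ℚ)}
    (hq : Kato.IsKolyvaginPrime W p k ((Rat.HeightOneSpectrum.primesEquiv v : Nat.Primes) : ℕ)) :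
    W.HasGoodReductionAt v := by
  haveI := Fact.mk (Rat.HeightOneSpectrum.primesEquiv v).2
  exact (WeierstrassCurve.hasGoodReductionAtPrime_iff_hasGoodReductionAt_ringOfIntegers v W).mp
    (hasGoodReductionAtPrime_of_not_dvd_conductorNorm W hq.not_dvd_conductorNorm)

/-- **T-DER's binder `hM₂` over `ℚ` for `T = T_pE`**: for a `ℤ_p`-module `M'` killed by `p^k`, a
place `v` whose prime `q` is a Kolyvagin prime of level `k` for `(W, p)` (`q ∤ Np`, `q ≡ 1`,
`a_q ≡ q + 1 (mod p^k)`) and an arithmetic Frobenius `Fr` at `v`, the Euler factor value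
`P(Fr⁻¹ | T_pE*; 1)` kills `M'` — Rubin's `M ∣ P(Fr_q⁻¹ | T*; 1)`, i.e. `q ∈ 𝒫_M`. [folklore] -/
theorem eval_one_rubinEulerFactor_galoisRepTate_smul_eq_zero {k : ℕ} {M' : Type*} [AddCommGroup M']
    [Module ℤ_[p] M'] (hM : ∀ m : M', ((p : ℤ_[p]) ^ k) • m = 0) {v : HeightOneSpectrum (𝓞 ℚ)}
    (hq : Kato.IsKolyvaginPrime W p k ((Rat.HeightOneSpectrum.primesEquiv v : Nat.Primes) : ℕ))
    {Fr : absoluteGaloisGroup ℚ} (hFr : IsArithFrobAtPlace ℚ v Fr) (m : M') :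
    haveI := W.module_free_tateModule_holds p
    haveI := W.module_finite_tateModule_holds p
    (rubinEulerFactor (W.galoisRepTate p) (cyclotomicCharacterToUnits ℚ p ℤ_[p]) Fr).eval 1 • m = 0 := by
  haveI := W.module_free_tateModule_holds p
  haveI := W.module_finite_tateModule_holds p
  set q : ℕ := ((Rat.HeightOneSpectrum.primesEquiv v : Nat.Primes) : ℕ) with hqdef
  have hne : q ≠ p := hq.ne
  have hv : W.HasGoodReductionAt v := hasGoodReductionAt_of_isKolyvaginPrime W hq
  obtain ⟨u, hu, -⟩ := rubinEulerFactor_galoisRepTate W p hne hv hFr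
  set e := (rubinEulerFactor (W.galoisRepTate p) (cyclotomicCharacterToUnits ℚ p ℤ_[p]) Fr).eval 1
    with hedef
  have hmul : e * (q : ℤ_[p]) = (q : ℤ_[p]) + 1 - (W.frobeniusTrace (Rat.HeightOneSpectrum.primesEquiv v) : ℤ_[p]) :=
    eval_one_rubinEulerFactor_galoisRepTate_mul W p hne hv hFr
  -- `a_q ≡ q + 1 (mod p^k)`: `q + 1 − a_q = p^k · t`
  obtain ⟨t, ht⟩ := (Int.ModEq.dvd hq.frobeniusTrace_modEq)
  have hcast : (q : ℤ_[p]) + 1 - (W.frobeniusTrace (Rat.HeightOneSpectrum.primesEquiv v) : ℤ_[p]) =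
      ((p : ℤ_[p]) ^ k) * (t : ℤ_[p]) := by
    have h := congrArg (fun z : ℤ ↦ (z : ℤ_[p])) ht
    push_cast at h
    linear_combination h
  -- `e • m = u⁻¹ • ((e·q) • m) = u⁻¹ • (t • (p^k • m)) = 0`
  have he : e = ((u⁻¹ : ℤ_[p]ˣ) : ℤ_[p]) * (e * (q : ℤ_[p])) := by
    rw [← hu, mul_comm e, ← mul_assoc, Units.inv_mul, one_mul]
  rw [he, hmul, hcast, mul_smul, mul_comm, mul_smul, hM, smul_zero, smul_zero]

omit [W.IsElliptic] in
/-- **T-DER's binder `hM₁` over `ℚ`**: `N_q = q − 1` kills every `ℤ_p`-module killed by `p^k` when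
`q ≡ 1 (mod p^k)` (a Kolyvagin prime of level `k`) — Rubin's `M ∣ N_q = [ℚ(μ_q) : ℚ]`. [folklore] -/
theorem natCast_sub_one_smul_eq_zero_of_isKolyvaginPrime {k : ℕ} {M' : Type*} [AddCommGroup M']
    [Module ℤ_[p] M'] (hM : ∀ m : M', ((p : ℤ_[p]) ^ k) • m = 0) {v : HeightOneSpectrum (𝓞 ℚ)}
    (hq : Kato.IsKolyvaginPrime W p k ((Rat.HeightOneSpectrum.primesEquiv v : Nat.Primes) : ℕ))
    (m : M') :
    (((((Rat.HeightOneSpectrum.primesEquiv v : Nat.Primes) : ℕ) - 1 : ℕ) : ℤ_[p])) • m = 0 := by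
  obtain ⟨t, ht⟩ := (Nat.modEq_iff_dvd' hq.prime.one_lt.le).mp hq.modEq_one.symm
  rw [ht, Nat.cast_mul, Nat.cast_pow, mul_comm, mul_smul, hM, smul_zero]

end Rat

end Summit.BirchSwinnertonDyer.Rank1Residual.GaloisImage.CyclotomicLevel

end
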